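import Summits.BirchSwinnertonDyer.Rank1Residual.Additive.X3RankZeroCyclotomicThreeUnitRows
import Summits.BirchSwinnertonDyer.Rank1Residual.Additive.CyclotomicZpExtensionQuadratic
import Summits.BirchSwinnertonDyer.Rank1Residual.Additive.CyclotomicThreeReduction
import Literature.NumberTheory.EllipticCurves.Greenberg1999.EulerCharacteristicNumberField
import Literature.NumberTheory.EllipticCurves.Rank1Residual.Typed.CasselsLowerBound
import HarnessLib

/-!
# Line V14 from NAMED FACTS ONLY: `ord₃ #Ш(V) + ord₃ #Ш(W) ≤ ord₃ #Ш_an(V) + ord₃ #Ш_an(W)` and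
# `BSD(W,3) ∧ BSD(V,3)` on the doubly-unit rows — no inline hypothesis left

HONEST FRAMING (cell `b2b-bsdres`, run/shared/lean/b2b/bsd-rank1-residual/, verbatim in every
file): the goal of the cell is to DELETE the COMBINATION-SHAPED residual classes of the
Birch–Swinnerton-Dyer formula for ALL analytic-rank `≤ 1` elliptic curves over `ℚ` — "full BSD
formula for every rank `≤ 1` curve in class `C`" assembled STRICTLY from published theorems — so
that the rank-`≤ 1` remainder becomes exactly the CONSTRUCTION-SHAPED classes, which are TYPED
(missing-input `Prop`s), NOT attempted. This is not "finishing BSD". The additive sub-cell (seats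
additive-p1…p4) is a RESEARCH ROUTE on the construction-shaped classes X3/X4; no claim beyond the
stated classes; the labels of X3 (and of X1, the class of the twist pairs) are UNCHANGED by this file;
nothing is booked here (booking is the referee's call).

Theorems only (no `def`, no `sorry`, no new named fact). The core theorem of line V14
(`X3CyclotomicThree.exists_padicVal_shaOrder_add_le`, file `X3RankZeroCyclotomicThree.lean`; its
docstring has the mathematics) carried four inline hypotheses: `hW16K` (Wuthrich 2014 Thm. 16 over
`K = ℚ(ζ₃)` — the named fact `Wuthrich2014.charIdeal_dvd_padicLFunction_cyclotomicThree`, consumed in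
`X3RankZeroCyclotomicThreeUnitRows`), `hD1` (odd-branch constant term — PROVED,
`ChiBranchConstantTermOdd`), `hexK` (the cyclotomic `ℤ₃`-extension of `K` with a normalised generator —
PROVED, `CyclotomicZpExtensionQuadratic.exists_isCyclotomic_isTopGenerator_cyclotomicThree`) and `hGrK`
(Greenberg's Thm. 4.1 over `K` in its `K`-shape). Here the last one is DERIVED from the verbatim
number-field statement — the named fact
`Literature.NumberTheory.EllipticCurves.Greenberg1999.thm41_charValue_rankZero_numberField` — by the
`K`-side reduction data of `CyclotomicThreeReduction` (`3` totally ramified in `K`, `𝔭 = (ζ₃ − 1)`,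
`k_𝔭 = 𝔽₃`, `#Ẽ_𝔭(k_𝔭)[3^∞] = #V(𝔽₃)[3^∞]`, `a_𝔭(V_K) = a₃(V)`, good reduction at `𝔭`), and the
auxiliary field `K` is instantiated (`CyclotomicField 3 ℚ`), so that the statements below mention only
`V`, `W` and the published inputs:

* `X3CyclotomicThree.greenbergK_of_fact` — `hGrK` from the named fact;
* `X3CyclotomicThree.exists_padicVal_shaOrder_add_le_of_facts` — for `V/ℚ` globally minimal, good
  ordinary at `3` with `V[3]` reducible, `W = C • V^{(−3)}` globally minimal and additive at `3`, both
  of analytic rank `0`: `#Ш_an(V) = q_V`, `#Ш_an(W) = q_W` are rationals with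
  `ord₃ #Ш(V) + ord₃ #Ш(W) ≤ ord₃ q_V + ord₃ q_W`, from EXACTLY: Wuthrich 2014 Thm. 16 (`p = 3`, over
  `ℚ(ζ₃)`; fact), Greenberg 1999 Thm. 4.1 (number fields; fact), Milne 1972 (Dokchitser–Dokchitser's
  model-free form; fact), modularity (`hmod`, `hmodD`) and Gross–Zagier–Kolyvagin (`hGZK`);
* `X3CyclotomicThree.missingUpperBoundAt_of_facts` — `3 ∤ #Ш_an(V)` ⇒ the cell's typed UPPER half
  `Typed.MissingUpperBoundAt W 3` for the additive curve `W`;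
* `X3CyclotomicThree.bsdp_of_shaAn_units_of_facts` — both `#Ш_an` units ⇒ `BSD(W,3) ∧ BSD(V,3)`.

Census (cell, N < 2·10⁴): X3 ∧ (G-ord, e = 2) ∧ `p = 3` ∧ ranks `(0,0)`: 79 CORE-open pairs, 78
doubly-unit. Labels UNCHANGED; nothing booked.
-/

noncomputable section

open scoped Classical MatrixGroups ModularForm

open CongruenceSubgroup WeierstrassCurve NumberField IsDedekindDomain
  Literature.NumberTheory.EllipticCurves Literature.NumberTheory.EllipticCurves.ModularForms
  Literature.NumberTheory.EllipticCurves.Rank1Residual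
  Literature.NumberTheory.EllipticCurves.Rank1Residual.Typed
  Literature.NumberTheory.GaloisRepresentations

namespace Summit.BirchSwinnertonDyer.Rank1Residual.Additive

/-! ## §1 `hGrK` from Greenberg's Theorem 4.1 over number fields -/

section GreenbergK

variable (K : Type) [Field K] [NumberField K] [IsCyclotomicExtension {3} ℚ K]
  (V : WeierstrassCurve ℚ) [V.IsElliptic] [V.IsGloballyMinimal]

/-- **Greenberg's Theorem 4.1 for `V_K`, `K = ℚ(ζ₃)`, in the `K`-shape of line V14** (the inline
hypothesis `hGrK` of `X3CyclotomicThree.exists_padicVal_shaOrder_add_le`), DERIVED from the verbatim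
number-field statement `Greenberg1999.thm41_charValue_rankZero_numberField`: for `V/ℚ` globally
minimal good ordinary at `3`, the only prime of `K` above `3` is `𝔭 = (ζ₃ − 1)` with `k_𝔭 = 𝔽₃`, `V_K`
has good ordinary reduction there with `a_𝔭(V_K) = a₃(V)`, and `#Ẽ_𝔭(𝔽₃)[3^∞] = #V(𝔽₃)[3^∞]`
(`CyclotomicThreeReduction`). [cite: GreenbergLNM1716, Thm. 4.1 (p. 102)] -/
theorem X3CyclotomicThree.greenbergK_of_fact
    (hGr : Greenberg1999.thm41_charValue_rankZero_numberField) (hord : IsOrdinaryAt V 3) :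
    ∀ (κ : ZpExtension K 3) (γ : Field.absoluteGaloisGroup K),
        κ.IsCyclotomic → κ.IsTopGenerator γ →
      ∀ (D : (V.baseChange K).SelmerDualData κ γ) [Module.Finite (IwasawaAlgebra 3) D.X], D.IsTorsion →
      ∀ (fE : IwasawaAlgebra 3), D.charIdeal = Ideal.span {fE} →
        Finite ((V.baseChange K).selmerGroupPInfty 3) →
        ∃ u : ℤ_[3]ˣ,
          ((PowerSeries.constantCoeff fE : ℤ_[3]) : ℚ_[3]) *
              (Nat.card (AddCommGroup.primaryComponent (V.baseChange K).toAffine.Point 3) : ℚ_[3]) ^ 2 =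
            ((u : ℤ_[3]) : ℚ_[3]) * (3 : ℚ_[3]) ^ (padicValNat 3 (V.baseChange K).tamagawaProduct) *
              (Nat.card (AddCommGroup.primaryComponent
                ((integralModelInt V).map (Int.castRingHom (ZMod 3))).toAffine.Point 3) : ℚ_[3]) ^ 2 *
              (Nat.card ((V.baseChange K).selmerGroupPInfty 3) : ℚ_[3]) := by
  intro κ γ hκ hγ D _ hX fE hfE hfin
  haveI : (V.baseChange K).IsElliptic := by rw [baseChange]; infer_instance
  obtain ⟨𝔭, h3, hS, hN⟩ := exists_prime_over_three K
  have hΔ : ¬ (3 : ℤ) ∣ minimalDiscriminantInt V := fun hdvd ↦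
    V.not_hasGoodReductionAtPrime_of_dvd_minimalDiscriminantInt 3 hdvd hord.1
  have hgood : (V.baseChange K).HasGoodReductionAt 𝔭 :=
    (isMinimalAt_and_hasGoodReductionAt_baseChange_of_mem V (p := 3) (by exact_mod_cast hΔ) 𝔭 h3).2
  have hordK : ¬ ((3 : ℕ) : ℤ) ∣ (V.baseChange K).frobeniusTraceAt 𝔭 := by
    rw [frobeniusTraceAt_baseChange_eq_frobeniusTrace_three V 𝔭 h3 hN hΔ]
    exact hord.2
  obtain ⟨u, hu⟩ := hGr.of_unique_prime (V.baseChange K) 3 (by norm_num) 𝔭 hS hgood hordK κ γ hκ hγ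
    D hX fE hfE hfin
  refine ⟨u, ?_⟩
  rw [hu, natCard_primaryComponent_point_reductionAt_eq V 𝔭 h3 hN hΔ, Nat.cast_ofNat]

end GreenbergK

/-! ## §2 Line V14 from named facts only (the auxiliary field instantiated as `CyclotomicField 3 ℚ`) -/

section Facts

variable (V : WeierstrassCurve ℚ) [V.IsElliptic] [V.IsGloballyMinimal]
  (W : WeierstrassCurve ℚ) [W.IsElliptic] [W.IsGloballyMinimal]

/-- **Line V14, core inequality, from named facts only.** Let `V/ℚ` be globally minimal, good ORDINARY
at `3` with `V[3]` REDUCIBLE, and `W = C • V^{(−3)}` a globally minimal model of its twist by `−3`,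
ADDITIVE at `3` (the X3 ∧ (G-ord, `e = 2`) situation at `p = 3`), both of analytic rank `0`. Then
`#Ш_an(V) = q_V` and `#Ш_an(W) = q_W` are rationals with
**`ord₃ #Ш(V) + ord₃ #Ш(W) ≤ ord₃ q_V + ord₃ q_W`**, granted EXACTLY the published inputs: Wuthrich 2014
Thm. 16 at `p = 3` over `ℚ(ζ₃)` (`hW16`, named fact), Greenberg 1999 Thm. 4.1 over number fields
(`hGr`, named fact), Milne 1972 in Dokchitser–Dokchitser's model-free form (`hMilne`, named fact),
modularity (`hmod`, `hmodD`) and Gross–Zagier–Kolyvagin (`hGZK`). The cyclotomic setting over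
`K = ℚ(ζ₃)` (former `hexK`), the odd-branch constant term (former `hD1`) and the `K`-shape of
Greenberg's theorem (former `hGrK`) are THEOREMS; `K` is instantiated as `CyclotomicField 3 ℚ`.
Mathematics: docstring of `X3CyclotomicThree.exists_padicVal_shaOrder_add_le`.
[cite: Wuthrich2014, Thm. 16 (p. 397)] [cite: GreenbergLNM1716, Thm. 4.1 (p. 102)]
[cite: Milne1972ArithmeticAV, §1 Thm. 1] -/
theorem X3CyclotomicThree.exists_padicVal_shaOrder_add_le_of_facts
    (hW16 : Wuthrich2014.charIdeal_dvd_padicLFunction_cyclotomicThree)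
    (hGr : Greenberg1999.thm41_charValue_rankZero_numberField)
    (hMilne : Milne1972.bsdQuotient_baseChange_quadratic_anyModel)
    (hGZK : rank_eq_analyticRank_of_analyticRank_le_one) (hmod : hasEntireLFunction_rat)
    (hmodD : nonempty_modularParametrizationData)
    (C : VariableChange ℚ) (hC : C • V.quadraticTwist (-(3 : ℚ)) = W)
    (hord : IsOrdinaryAt V 3) (hred : ¬ V.HasIrreducibleModPGaloisRep 3) (hadd : Addv W 3)
    (hrV : V.analyticRank = 0) (hrW : W.analyticRank = 0) :
    ∃ qV qW : ℚ, shaAn V = (qV : ℂ) ∧ shaAn W = (qW : ℂ) ∧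
      (padicValNat 3 V.shaOrder : ℤ) + padicValNat 3 W.shaOrder ≤ padicValRat 3 qV + padicValRat 3 qW := by
  haveI : IsCyclotomicExtension {3} ℚ (CyclotomicField 3 ℚ) := CyclotomicField.isCyclotomicExtension 3 ℚ
  exact X3CyclotomicThree.exists_padicVal_shaOrder_add_le_of_fact (CyclotomicField 3 ℚ) V W hW16 hGZK
    hmod hmodD hMilne C hC hord hred hadd hrV hrW
    (exists_isCyclotomic_isTopGenerator_cyclotomicThree (CyclotomicField 3 ℚ))
    (X3CyclotomicThree.greenbergK_of_fact (CyclotomicField 3 ℚ) V hGr hord)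

/-- **The cell's typed UPPER half for the additive curve, from named facts only.** In the situation
of `X3CyclotomicThree.exists_padicVal_shaOrder_add_le_of_facts`, if `#Ш_an(V)` has non-positive
`3`-adic valuation (e.g. `3 ∤ #Ш_an(V)`, a census bit of the TWIST pair), then
`ord₃ #Ш(W) ≤ ord₃ #Ш_an(W)`, i.e. `Typed.MissingUpperBoundAt W 3`.
[cite: Wuthrich2014, Thm. 16 (p. 397)] [cite: GreenbergLNM1716, Thm. 4.1 (p. 102)] -/
theorem X3CyclotomicThree.missingUpperBoundAt_of_facts
    (hW16 : Wuthrich2014.charIdeal_dvd_padicLFunction_cyclotomicThree)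
    (hGr : Greenberg1999.thm41_charValue_rankZero_numberField)
    (hMilne : Milne1972.bsdQuotient_baseChange_quadratic_anyModel)
    (hGZK : rank_eq_analyticRank_of_analyticRank_le_one) (hmod : hasEntireLFunction_rat)
    (hmodD : nonempty_modularParametrizationData)
    (C : VariableChange ℚ) (hC : C • V.quadraticTwist (-(3 : ℚ)) = W)
    (hord : IsOrdinaryAt V 3) (hred : ¬ V.HasIrreducibleModPGaloisRep 3) (hadd : Addv W 3)
    (hrV : V.analyticRank = 0) (hrW : W.analyticRank = 0)
    {qV : ℚ} (hqV : shaAn V = (qV : ℂ)) (hv : padicValRat 3 qV ≤ 0) :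
    MissingUpperBoundAt W 3 := by
  obtain ⟨qV', qW, hqV', hqW, hle⟩ := X3CyclotomicThree.exists_padicVal_shaOrder_add_le_of_facts V W
    hW16 hGr hMilne hGZK hmod hmodD C hC hord hred hadd hrV hrW
  have hqq : qV' = qV := by exact_mod_cast hqV'.symm.trans hqV
  subst hqq
  refine ⟨qW, hqW, ?_⟩
  have h0 : (0 : ℤ) ≤ padicValNat 3 V.shaOrder := by positivity
  linarith

/-- **`BSD(W,3) ∧ BSD(V,3)` on the doubly-unit rows, from named facts only.** In the situation of
`X3CyclotomicThree.exists_padicVal_shaOrder_add_le_of_facts`, if `#Ш_an(V)` and `#Ш_an(W)` are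
`3`-adic units then Miller's `BSD(W,3)` and `BSD(V,3)` hold — for the ADDITIVE X3 pair `(W,3)` (type
`I₀*`, `W[3]` reducible) and its good ordinary Eisenstein twist pair `(V,3)` simultaneously. Census
(cell, N < 2·10⁴): 78 of the 79 CORE-open rank-`(0,0)` X3 ∧ (G-ord, `e = 2`) pairs at `p = 3` are
doubly-unit. Inputs: three named published facts (`hW16`, `hGr`, `hMilne`), modularity (`hmod`,
`hmodD`), GZK (`hGZK`) — nothing else. Labels UNCHANGED; nothing booked by this theorem.
[cite: Wuthrich2014, Thm. 16 (p. 397)] [cite: GreenbergLNM1716, Thm. 4.1 (p. 102)]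
[cite: Milne1972ArithmeticAV, §1 Thm. 1] -/
theorem X3CyclotomicThree.bsdp_of_shaAn_units_of_facts
    (hW16 : Wuthrich2014.charIdeal_dvd_padicLFunction_cyclotomicThree)
    (hGr : Greenberg1999.thm41_charValue_rankZero_numberField)
    (hMilne : Milne1972.bsdQuotient_baseChange_quadratic_anyModel)
    (hGZK : rank_eq_analyticRank_of_analyticRank_le_one) (hmod : hasEntireLFunction_rat)
    (hmodD : nonempty_modularParametrizationData)
    (C : VariableChange ℚ) (hC : C • V.quadraticTwist (-(3 : ℚ)) = W)
    (hord : IsOrdinaryAt V 3) (hred : ¬ V.HasIrreducibleModPGaloisRep 3) (hadd : Addv W 3)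
    (hrV : V.analyticRank = 0) (hrW : W.analyticRank = 0)
    {qV qW : ℚ} (hqV : shaAn V = (qV : ℂ)) (hqW : shaAn W = (qW : ℂ))
    (hvV : padicValRat 3 qV = 0) (hvW : padicValRat 3 qW = 0) : BSDp W 3 ∧ BSDp V 3 := by
  haveI : IsCyclotomicExtension {3} ℚ (CyclotomicField 3 ℚ) := CyclotomicField.isCyclotomicExtension 3 ℚ
  exact X3CyclotomicThree.bsdp_of_shaAn_units_of_fact (CyclotomicField 3 ℚ) V W hW16 hGZK hmod hmodD
    hMilne C hC hord hred hadd hrV hrW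
    (exists_isCyclotomic_isTopGenerator_cyclotomicThree (CyclotomicField 3 ℚ))
    (X3CyclotomicThree.greenbergK_of_fact (CyclotomicField 3 ℚ) V hGr hord) hqV hqW hvV hvW

/-- **The `3 ∣ #Ш_an(W)` rows: `BSD(W,3)` from ONE finite certificate, named facts otherwise**
(X3 ∧ (G-ord, `e = 2`) ∧ `p = 3` ∧ ranks `(0,0)`, `3 ∤ #Ш_an(V)`). If `#Ш_an(W) = q` with
`ord₃ q ≤ 2k` and `3^{2k−1} ∣ #Ш(W)` (for `k = 1`: `Ш(W)[3] ≠ 0`, a `3`-descent certificate), then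
`BSD(W,3)`: the upper half is `X3CyclotomicThree.missingUpperBoundAt_of_facts`, the lower half is
Cassels–Tate squareness (`hCT` = bsd.S18, `missingLowerBoundAt_of_casselsTate_of_pow_dvd`). Census
(hyp v14/V14-CENSUS.md, two engines): the only rank-`(0,0)` row with `3 ∣ #Ш_an(W)` is 7632m1
(`#Ш_an = 9`, `k = 1`; sha-2 certifies `Ш(W)[3] ≠ 0`). Nothing booked by this theorem.
[cite: Wuthrich2014, Thm. 16 (p. 397)] [cite: GreenbergLNM1716, Thm. 4.1 (p. 102)]
[cite: SilvermanAEC2009, Thm. X.4.14] [cite: Miller2011LMS, §1 and Def. 1.1] -/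
theorem X3CyclotomicThree.bsdp_of_casselsTate_of_pow_dvd_of_facts
    (hW16 : Wuthrich2014.charIdeal_dvd_padicLFunction_cyclotomicThree)
    (hGr : Greenberg1999.thm41_charValue_rankZero_numberField)
    (hMilne : Milne1972.bsdQuotient_baseChange_quadratic_anyModel)
    (hGZK : rank_eq_analyticRank_of_analyticRank_le_one) (hmod : hasEntireLFunction_rat)
    (hmodD : nonempty_modularParametrizationData) (hCT : exists_casselsTate_pairing (K := ℚ))
    (C : VariableChange ℚ) (hC : C • V.quadraticTwist (-(3 : ℚ)) = W)
    (hord : IsOrdinaryAt V 3) (hred : ¬ V.HasIrreducibleModPGaloisRep 3) (hadd : Addv W 3)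
    (hrV : V.analyticRank = 0) (hrW : W.analyticRank = 0)
    {qV : ℚ} (hqV : shaAn V = (qV : ℂ)) (hvV : padicValRat 3 qV ≤ 0)
    {q : ℚ} (hq : shaAn W = (q : ℂ)) {k : ℕ} (hv : padicValRat 3 q ≤ 2 * k)
    (hdvd : 3 ^ (2 * k - 1) ∣ W.shaOrder) : BSDp W 3 :=
  bsdp_of_missingPPartAt W 3 hGZK (by rw [hrW]; exact zero_le_one)
    (missingPPartAt_of_lower_of_upper W 3
      (missingLowerBoundAt_of_casselsTate_of_pow_dvd W 3 hCT (hGZK W (by rw [hrW]; exact zero_le_one)).2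
        hq hv hdvd)
      (X3CyclotomicThree.missingUpperBoundAt_of_facts V W hW16 hGr hMilne hGZK hmod hmodD C hC hord hred
        hadd hrV hrW hqV hvV))

end Facts

end Summit.BirchSwinnertonDyer.Rank1Residual.Additive

end
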